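import Summits.CriticalPhenomena.PercolationContinuityZ3.Theorems.PercNearOneGluingNoHeavyLowerTailKnQuestion8CoefficientwiseRootSetKernelRowTwoCore
import HarnessLib

/-!
# The root-set kernel: ROW 2 of RCSET is a theorem — prim-lf-2 gen 59

Support file (`--supports stmt-CriticalPhenomena-4575`, closed), prover `prim-lf-2` (gen 59).  No definitions, no named facts, no sorries; standard axioms.
Memo `prim-lf-2/CW-KERNEL-gen59.md` §2; companions `…CoefficientwiseRootSetKernelRowTwoPrep.lean` (primitives, swap inequality, box bounds),
`…CoefficientwiseRootSetKernelTop.lean` (row 1 = `rcset_top_row`), `…CoefficientwiseRootSetKernelBridge.lean` (RCSET ⟹ NO-CORE).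

THE ROOT-SET KERNEL (memo CW-IGCEX-gen58 §8b).  Multigraph `ends : ι → Sym2 V`, edge set `E`, target `y`; `R_A(t) = {v | ∃ a ∈ A, v ∈ C_a(t)}` (red cluster of the SET `A`),
`B_A(t) = R_A(E ∖ t)`, `Φ(A, A') = Σ_{t ⊆ E : ¬(y ∈ R_A(t) ∧ y ∈ B_{A'}(t))} (f R_A(t) − f B_{A'}(t))·(g R_A(t) − g B_{A'}(t))`.
CONJECTURE RCSET (prim-lf-2 gen 58): `Φ(S',S') ≤ 2·Φ(S,S')` for nested root sets `S ⊆ S' ∌ y`; its bottom pair `({x},{x,p})` is CONJECTURE NO-CORE (`noCore_of_rcset_pair`),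
its top row `S' = V ∖ y` is `rcset_top_row`.
* `Coefficientwise.rcset_row_two` — **THEOREM: ROW 2 of RCSET** (generic position).  For finite `V`, `y ≠ q`, `U = V ∖ {y,q}`, a root set `S` with `y, q ∉ S`, monotone `f, g`,
  provided `q ∼ y`, `U ∼ y` and `U ∼ q` in `E` (some edge of each kind):  `Φ(U,U) ≤ 2·Φ(S,U)`.
Proof (memo §2).  (i) Swap inequality (`diag_le_two_mul_sum_notBlue`): `Φ(U,U) ≤ 2 Σ_{t : y ∉ B_U(t)} T_U(t)`.  (ii) Split every colouring as `t = τ ∪ ω` (inner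
edges / outer edges `Out = Aq ∪ By ∪ Cq`: the `U–q`, `U–y`, `q–y` edges; `sum_powerset_union_of_disjoint`) and fix `τ`.  (iii) For fixed `τ` the maps
`ω ↦ R_S(τ∪ω), R_U(τ∪ω), B_U(τ∪ω)` satisfy the axioms of `rcset_row_two_core` (elementary connectivity: `setCluster_step`, `not_mem_setCluster_of_isolated`,
`setCluster_subset_of_closed`), which gives the slice inequality `Σ_{ω : y ∉ B_U} T_U(τ∪ω) ≤ Σ_{ω admissible} T_S(τ∪ω)`.
Census behind RCSET row 2 (exact over ALL monotone pairs, co-independent normal forms; prim-lf-2 gen 59 `code/gen59/c/cobip*.c`): 0 violations.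
(Decidability instances on `ι` are the classical ones, as in `diag_le_two_mul_sum_notBlue`.)
[cite: KozmaNitzan2024, Questions 8–9 (§5.5 p. 36) (context: the Question-8 pocket covariance programme)]
-/

namespace Summit.CriticalPhenomena.PercolationContinuityZ3.Theorems

open Finset Literature.Probability.Percolation

namespace Coefficientwise

variable {ι V : Type*}

open Classical in
/-- **Row 2 of RCSET** (see the module docstring): for finite `V`, `y ≠ q`, `U = V ∖ {y, q}`, `y, q ∉ S`, monotone `f, g`, and an edge of each kind `U–q`, `U–y`, `q–y` in `E`:
`Φ(U,U) ≤ 2·Φ(S,U)` for the root-set kernel `Φ` of `(ends, E, y, f, g)`. [cite: KozmaNitzan2024, Questions 8–9 (§5.5 p. 36) (context)] -/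
theorem rcset_row_two [Fintype V] [DecidableEq V] (ends : ι → Sym2 V) (E : Finset ι) (y q : V) (hyq : y ≠ q) (S : Finset V) (hyS : y ∉ S) (hqS : q ∉ S)
    (hAq : ∃ i ∈ E, ∃ u : V, u ≠ q ∧ u ≠ y ∧ ends i = s(u, q)) (hBy : ∃ i ∈ E, ∃ u : V, u ≠ q ∧ u ≠ y ∧ ends i = s(u, y)) (hCq : ∃ i ∈ E, ends i = s(q, y))
    (f g : Set V → ℝ) (hf : Monotone f) (hg : Monotone g) :
    (∑ s ∈ E.powerset.filter (fun s : Finset ι =>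
          ¬ ((∃ a ∈ ((Finset.univ : Finset V).erase y).erase q, y ∈ openCluster (ends '' (↑s : Set ι)) a) ∧
             (∃ a ∈ ((Finset.univ : Finset V).erase y).erase q, y ∈ openCluster (ends '' (↑(E \ s) : Set ι)) a))),
        (f {v | ∃ a ∈ ((Finset.univ : Finset V).erase y).erase q, v ∈ openCluster (ends '' (↑s : Set ι)) a} -
            f {v | ∃ a ∈ ((Finset.univ : Finset V).erase y).erase q, v ∈ openCluster (ends '' (↑(E \ s) : Set ι)) a}) *
          (g {v | ∃ a ∈ ((Finset.univ : Finset V).erase y).erase q, v ∈ openCluster (ends '' (↑s : Set ι)) a} -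
            g {v | ∃ a ∈ ((Finset.univ : Finset V).erase y).erase q, v ∈ openCluster (ends '' (↑(E \ s) : Set ι)) a})) ≤
    2 * ∑ s ∈ E.powerset.filter (fun s : Finset ι =>
          ¬ ((∃ a ∈ S, y ∈ openCluster (ends '' (↑s : Set ι)) a) ∧
             (∃ a ∈ ((Finset.univ : Finset V).erase y).erase q, y ∈ openCluster (ends '' (↑(E \ s) : Set ι)) a))),
        (f {v | ∃ a ∈ S, v ∈ openCluster (ends '' (↑s : Set ι)) a} -
            f {v | ∃ a ∈ ((Finset.univ : Finset V).erase y).erase q, v ∈ openCluster (ends '' (↑(E \ s) : Set ι)) a}) *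
          (g {v | ∃ a ∈ S, v ∈ openCluster (ends '' (↑s : Set ι)) a} -
            g {v | ∃ a ∈ ((Finset.univ : Finset V).erase y).erase q, v ∈ openCluster (ends '' (↑(E \ s) : Set ι)) a}) := by
  have hswap := diag_le_two_mul_sum_notBlue ends E y q hyq f g hf hg
  -- notation
  set U : Finset V := ((Finset.univ : Finset V).erase y).erase q with hU
  set RU : Finset ι → Set V := fun t => {v | ∃ a ∈ U, v ∈ openCluster (ends '' (↑t : Set ι)) a} with hRU
  set RS : Finset ι → Set V := fun t => {v | ∃ a ∈ S, v ∈ openCluster (ends '' (↑t : Set ι)) a} with hRS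
  set admU : Finset ι → Prop := fun s => ¬ ((∃ a ∈ U, y ∈ openCluster (ends '' (↑s : Set ι)) a) ∧
      (∃ a ∈ U, y ∈ openCluster (ends '' (↑(E \ s) : Set ι)) a)) with hadmU
  set admS : Finset ι → Prop := fun s => ¬ ((∃ a ∈ S, y ∈ openCluster (ends '' (↑s : Set ι)) a) ∧
      (∃ a ∈ U, y ∈ openCluster (ends '' (↑(E \ s) : Set ι)) a)) with hadmS
  set TU : Finset ι → ℝ := fun s => (f (RU s) - f (RU (E \ s))) * (g (RU s) - g (RU (E \ s))) with hTU
  set TS : Finset ι → ℝ := fun s => (f (RS s) - f (RU (E \ s))) * (g (RS s) - g (RU (E \ s))) with hTS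
  change ∑ s ∈ E.powerset.filter admU, TU s ≤ 2 * ∑ s ∈ E.powerset.filter admS, TS s
  change ∑ s ∈ E.powerset.filter admU, TU s ≤ 2 * ∑ s ∈ E.powerset.filter (fun s => y ∉ RU (E \ s)), TU s at hswap
  suffices hmain : ∑ s ∈ E.powerset.filter (fun s => y ∉ RU (E \ s)), TU s ≤ ∑ s ∈ E.powerset.filter admS, TS s by linarith
  /- ### vertices -/
  have hyU : y ∉ U := fun h => (Finset.mem_erase.mp (Finset.mem_erase.mp h).2).1 rfl
  have hqU : q ∉ U := fun h => (Finset.mem_erase.mp h).1 rfl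
  have memU : ∀ v : V, v ≠ q → v ≠ y → v ∈ U := fun v h1 h2 => Finset.mem_erase.mpr ⟨h1, Finset.mem_erase.mpr ⟨h2, Finset.mem_univ v⟩⟩
  have hSU : (↑S : Set V) ⊆ ↑U := by
    intro v hv
    have hv' := Finset.mem_coe.mp hv
    exact Finset.mem_coe.mpr (memU v (fun h => hqS (h ▸ hv')) (fun h => hyS (h ▸ hv')))
  -- a set containing `U` and `q` contains every vertex but `y`; containing `q` and `y` too it is everything
  have fill_noty : ∀ X : Set V, (↑U : Set V) ⊆ X → q ∈ X → ∀ v, v ≠ y → v ∈ X := by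
    intro X hUX hqX v hvy
    by_cases hvq : v = q
    · exact hvq ▸ hqX
    · exact hUX (Finset.mem_coe.mpr (memU v hvq hvy))
  have fill_univ : ∀ X : Set V, (↑U : Set V) ⊆ X → q ∈ X → y ∈ X → X = Set.univ := by
    intro X hUX hqX hyX
    refine Set.eq_univ_of_forall fun v => ?_
    by_cases hvy : v = y
    · exact hvy ▸ hyX
    · exact fill_noty X hUX hqX v hvy
  have hUsubRU : ∀ t, (↑U : Set V) ⊆ RU t := fun t => subset_setCluster ends U t
  have hSsubRS : ∀ t, (↑S : Set V) ⊆ RS t := fun t => subset_setCluster ends S t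
  /- ### edge classes -/
  set Aq : Finset ι := E.filter (fun i => ∃ u : V, u ≠ q ∧ u ≠ y ∧ ends i = s(u, q)) with hAqdef
  set By : Finset ι := E.filter (fun i => ∃ u : V, u ≠ q ∧ u ≠ y ∧ ends i = s(u, y)) with hBydef
  set Cq : Finset ι := E.filter (fun i => ends i = s(q, y)) with hCqdef
  set Out : Finset ι := Aq ∪ By ∪ Cq with hOut
  set E' : Finset ι := E \ Out with hE'
  have hAqE : Aq ⊆ E := Finset.filter_subset _ E
  have hByE : By ⊆ E := Finset.filter_subset _ E
  have hCqE : Cq ⊆ E := Finset.filter_subset _ E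
  have hOutE : Out ⊆ E := Finset.union_subset (Finset.union_subset hAqE hByE) hCqE
  have hAqOut : Aq ⊆ Out := fun i hi => Finset.mem_union_left _ (Finset.mem_union_left _ hi)
  have hByOut : By ⊆ Out := fun i hi => Finset.mem_union_left _ (Finset.mem_union_right _ hi)
  have hCqOut : Cq ⊆ Out := fun i hi => Finset.mem_union_right _ hi
  have hAqne : Aq.Nonempty := by
    obtain ⟨i, hi, u, h1, h2, h3⟩ := hAq; exact ⟨i, Finset.mem_filter.mpr ⟨hi, u, h1, h2, h3⟩⟩
  have hByne : By.Nonempty := by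
    obtain ⟨i, hi, u, h1, h2, h3⟩ := hBy; exact ⟨i, Finset.mem_filter.mpr ⟨hi, u, h1, h2, h3⟩⟩
  have hCqne : Cq.Nonempty := by
    obtain ⟨i, hi, h3⟩ := hCq; exact ⟨i, Finset.mem_filter.mpr ⟨hi, h3⟩⟩
  -- ends of the classified edges
  have endsAq : ∀ i ∈ Aq, ∃ u : V, u ∈ U ∧ ends i = s(u, q) := by
    intro i hi; obtain ⟨_, u, h1, h2, h3⟩ := Finset.mem_filter.mp hi; exact ⟨u, memU u h1 h2, h3⟩
  have endsBy : ∀ i ∈ By, ∃ u : V, u ∈ U ∧ ends i = s(u, y) := by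
    intro i hi; obtain ⟨_, u, h1, h2, h3⟩ := Finset.mem_filter.mp hi; exact ⟨u, memU u h1 h2, h3⟩
  have endsCq : ∀ i ∈ Cq, ends i = s(q, y) := fun i hi => (Finset.mem_filter.mp hi).2
  -- disjointness
  have hAqBy : ∀ i, i ∈ Aq → i ∉ By := by
    intro i hi hi'
    obtain ⟨u, hu, h⟩ := endsAq i hi; obtain ⟨u', hu', h'⟩ := endsBy i hi'
    rw [h] at h'
    rcases Sym2.eq_iff.mp h' with ⟨_, h2⟩ | ⟨h1, _⟩
    · exact hyq h2.symm
    · exact hyU (h1 ▸ hu)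
  have hAqCq : ∀ i, i ∈ Aq → i ∉ Cq := by
    intro i hi hi'
    obtain ⟨u, hu, h⟩ := endsAq i hi; have h' := endsCq i hi'
    rw [h] at h'
    rcases Sym2.eq_iff.mp h' with ⟨h1, _⟩ | ⟨h1, _⟩
    · exact hqU (h1 ▸ hu)
    · exact hyU (h1 ▸ hu)
  have hByCq : ∀ i, i ∈ By → i ∉ Cq := by
    intro i hi hi'
    obtain ⟨u, hu, h⟩ := endsBy i hi; have h' := endsCq i hi'
    rw [h] at h'
    rcases Sym2.eq_iff.mp h' with ⟨h1, _⟩ | ⟨h1, _⟩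
    · exact hqU (h1 ▸ hu)
    · exact hyU (h1 ▸ hu)
  -- every non-loop edge of `E` at `y` (resp. `q`) is classified
  have at_y : ∀ i ∈ E, ∀ w : V, w ≠ y → ends i = s(w, y) → i ∈ By ∨ i ∈ Cq := by
    intro i hi w hwy h
    by_cases hwq : w = q
    · exact Or.inr (Finset.mem_filter.mpr ⟨hi, by rw [h, hwq]⟩)
    · exact Or.inl (Finset.mem_filter.mpr ⟨hi, w, hwq, hwy, h⟩)
  have at_q : ∀ i ∈ E, ∀ w : V, w ≠ q → ends i = s(w, q) → i ∈ Aq ∨ i ∈ Cq := by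
    intro i hi w hwq h
    by_cases hwy : w = y
    · exact Or.inr (Finset.mem_filter.mpr ⟨hi, by rw [h, hwy, Sym2.eq_swap]⟩)
    · exact Or.inl (Finset.mem_filter.mpr ⟨hi, w, hwq, hwy, h⟩)
  -- closure of `U` under the unclassified edges and the `q–y` edges
  have closedU : ∀ i ∈ E, i ∉ Aq → i ∉ By → ∀ u w : V, ends i = s(u, w) → u ∈ (↑U : Set V) → w ∈ (↑U : Set V) := by
    intro i hi hiA hiB u w h hu
    have hu' := Finset.mem_coe.mp hu
    have huq : u ≠ q := fun e => hqU (e ▸ hu')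
    have huy : u ≠ y := fun e => hyU (e ▸ hu')
    by_cases hwq : w = q
    · exact absurd (Finset.mem_filter.mpr ⟨hi, u, huq, huy, by rw [h, hwq]⟩) hiA
    by_cases hwy : w = y
    · exact absurd (Finset.mem_filter.mpr ⟨hi, u, huq, huy, by rw [h, hwy]⟩) hiB
    exact Finset.mem_coe.mpr (memU w hwq hwy)
  /- ### cluster facts for colourings `t ⊆ E` -/
  -- (a) no `Aq`/`By` edge: the clusters of `S` and of `U` stay inside `U`
  have RS_sub_U : ∀ t : Finset ι, t ⊆ E → (∀ i ∈ t, i ∉ Aq) → (∀ i ∈ t, i ∉ By) → RS t ⊆ ↑U :=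
    fun t ht hA hB => setCluster_subset_of_closed ends hSU (fun i hi u w h hu => closedU i (ht hi) (hA i hi) (hB i hi) u w h hu)
  have RU_sub_U : ∀ t : Finset ι, t ⊆ E → (∀ i ∈ t, i ∉ Aq) → (∀ i ∈ t, i ∉ By) → RU t ⊆ ↑U :=
    fun t ht hA hB => setCluster_subset_of_closed ends subset_rfl (fun i hi u w h hu => closedU i (ht hi) (hA i hi) (hB i hi) u w h hu)
  -- (b) no `By`/`Cq` edge: `y` is not reached from `S` nor from `U`
  have y_notin_RS : ∀ t : Finset ι, t ⊆ E → (∀ i ∈ t, i ∉ By) → (∀ i ∈ t, i ∉ Cq) → y ∉ RS t := by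
    intro t ht hB hC
    refine not_mem_setCluster_of_isolated ends hyS fun i hi w hwy h => ?_
    rcases at_y i (ht hi) w hwy h with h' | h'
    · exact hB i hi h'
    · exact hC i hi h'
  have y_notin_RU : ∀ t : Finset ι, t ⊆ E → (∀ i ∈ t, i ∉ By) → (∀ i ∈ t, i ∉ Cq) → y ∉ RU t := by
    intro t ht hB hC
    refine not_mem_setCluster_of_isolated ends hyU fun i hi w hwy h => ?_
    rcases at_y i (ht hi) w hwy h with h' | h'
    · exact hB i hi h'
    · exact hC i hi h'
  -- (c) direct reaches
  have y_in_RU : ∀ t : Finset ι, (∃ j ∈ By, j ∈ t) → y ∈ RU t := by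
    rintro t ⟨j, hj, hjt⟩
    obtain ⟨u, hu, h⟩ := endsBy j hj
    exact setCluster_step ends U hjt h (hUsubRU t (Finset.mem_coe.mpr hu))
  have q_in_RU : ∀ t : Finset ι, (∃ i ∈ Aq, i ∈ t) → q ∈ RU t := by
    rintro t ⟨i, hi, hit⟩
    obtain ⟨u, hu, h⟩ := endsAq i hi
    exact setCluster_step ends U hit h (hUsubRU t (Finset.mem_coe.mpr hu))
  have q_of_y_RU : ∀ t : Finset ι, y ∈ RU t → (∃ k ∈ Cq, k ∈ t) → q ∈ RU t := by
    rintro t hy ⟨k, hk, hkt⟩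
    have h := endsCq k hk
    exact setCluster_step ends U hkt (by rw [h, Sym2.eq_swap]) hy
  have y_of_q_RU : ∀ t : Finset ι, q ∈ RU t → (∃ k ∈ Cq, k ∈ t) → y ∈ RU t := by
    rintro t hq ⟨k, hk, hkt⟩
    exact setCluster_step ends U hkt (endsCq k hk) hq
  have y_of_q_RS : ∀ t : Finset ι, q ∈ RS t → (∃ k ∈ Cq, k ∈ t) → y ∈ RS t := by
    rintro t hq ⟨k, hk, hkt⟩
    exact setCluster_step ends S hkt (endsCq k hk) hq
  /- ### decomposition `E = E' ∪ Out` and reduction to a fixed inner colouring `τ` -/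
  have hdisj : Disjoint E' Out := Finset.sdiff_disjoint
  have hEE : E' ∪ Out = E := Finset.sdiff_union_of_subset hOutE
  rw [Finset.sum_filter, Finset.sum_filter]
  rw [show (∑ s ∈ E.powerset, if y ∉ RU (E \ s) then TU s else 0) =
      ∑ τ ∈ E'.powerset, ∑ ω ∈ Out.powerset, (if y ∉ RU (E \ (τ ∪ ω)) then TU (τ ∪ ω) else 0) by
    rw [← sum_powerset_union_of_disjoint E' Out hdisj (fun s => if y ∉ RU (E \ s) then TU s else 0), hEE]]
  rw [show (∑ s ∈ E.powerset, if admS s then TS s else 0) =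
      ∑ τ ∈ E'.powerset, ∑ ω ∈ Out.powerset, (if admS (τ ∪ ω) then TS (τ ∪ ω) else 0) by
    rw [← sum_powerset_union_of_disjoint E' Out hdisj (fun s => if admS s then TS s else 0), hEE]]
  refine Finset.sum_le_sum fun τ hτ => ?_
  have hτE' : τ ⊆ E' := Finset.mem_powerset.mp hτ
  have hτE : τ ⊆ E := hτE'.trans Finset.sdiff_subset
  have hτOut : ∀ i ∈ τ, i ∉ Out := fun i hi => (Finset.mem_sdiff.mp (hτE' hi)).2
  have hτAq : ∀ i ∈ τ, i ∉ Aq := fun i hi h => hτOut i hi (hAqOut h)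
  have hτBy : ∀ i ∈ τ, i ∉ By := fun i hi h => hτOut i hi (hByOut h)
  have hτCq : ∀ i ∈ τ, i ∉ Cq := fun i hi h => hτOut i hi (hCqOut h)
  /- ### the slice at `τ`: instantiate the combinatorial core with `ω ↦ R_S(τ∪ω), R_U(τ∪ω), B_U(τ∪ω)` -/
  have sE : ∀ ω : Finset ι, ω ⊆ Out → τ ∪ ω ⊆ E := fun ω hω => Finset.union_subset hτE (hω.trans hOutE)
  -- an `Out`-edge outside `ω` is blue
  have blue_of : ∀ ω : Finset ι, ∀ i ∈ Out, i ∉ ω → i ∈ E \ (τ ∪ ω) := by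
    intro ω i hi hiω
    refine Finset.mem_sdiff.mpr ⟨hOutE hi, fun h => ?_⟩
    rcases Finset.mem_union.mp h with h | h
    · exact hτOut i h hi
    · exact hiω h
  have hRC : ∀ ω : Finset ι, ω ⊆ Aq ∪ By ∪ Cq → RS (τ ∪ ω ∩ Cq) ⊆ ↑U := by
    intro ω hω
    refine RS_sub_U _ (sE _ (Finset.inter_subset_left.trans hω)) ?_ ?_
    · intro i hi hiA
      rcases Finset.mem_union.mp hi with h | h
      · exact hτAq i h hiA
      · exact hAqCq i hiA (Finset.mem_inter.mp h).2
    · intro i hi hiB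
      rcases Finset.mem_union.mp hi with h | h
      · exact hτBy i h hiB
      · exact hByCq i hiB (Finset.mem_inter.mp h).2
  have hBUτ : ∀ ω : Finset ι, Aq ⊆ ω → By ⊆ ω → RU (E \ (τ ∪ ω)) ⊆ ↑U := by
    intro ω hA hB
    refine RU_sub_U _ Finset.sdiff_subset ?_ ?_
    · intro i hi hiA; exact (Finset.mem_sdiff.mp hi).2 (Finset.mem_union_right _ (hA hiA))
    · intro i hi hiB; exact (Finset.mem_sdiff.mp hi).2 (Finset.mem_union_right _ (hB hiB))
  have hyA : ∀ α : Finset ι, α ⊆ Aq → y ∉ RS (τ ∪ α) := by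
    intro α hα
    refine y_notin_RS _ (sE α (hα.trans hAqOut)) ?_ ?_
    · intro i hi hiB
      rcases Finset.mem_union.mp hi with h | h
      · exact hτBy i h hiB
      · exact hAqBy i (hα h) hiB
    · intro i hi hiC
      rcases Finset.mem_union.mp hi with h | h
      · exact hτCq i h hiC
      · exact hAqCq i (hα h) hiC
  have hyBn : ∀ ω : Finset ι, By ⊆ ω → Cq ⊆ ω → y ∉ RU (E \ (τ ∪ ω)) := by
    intro ω hB hC
    refine y_notin_RU _ Finset.sdiff_subset ?_ ?_
    · intro i hi hiB; exact (Finset.mem_sdiff.mp hi).2 (Finset.mem_union_right _ (hB hiB))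
    · intro i hi hiC; exact (Finset.mem_sdiff.mp hi).2 (Finset.mem_union_right _ (hC hiC))
  have hcore := rcset_row_two_core Aq By Cq hAqBy hAqCq hByCq hAqne hByne hCqne U y q hyU memU f g hf hg
    (fun ω => RS (τ ∪ ω)) (fun ω => RU (τ ∪ ω)) (fun ω => RU (E \ (τ ∪ ω))) (fun ω => hUsubRU _) (fun ω => hUsubRU _)
    (fun ω ω' h => setCluster_mono ends S (Finset.union_subset_union subset_rfl h)) hRC hBUτ hyA hyBn
    (fun ω ⟨j, hj, hjω⟩ => y_in_RU _ ⟨j, hj, blue_of ω j (hByOut hj) hjω⟩)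
    (fun ω ⟨i, hi, hiω⟩ => q_in_RU _ ⟨i, hi, blue_of ω i (hAqOut hi) hiω⟩)
    (fun ω hy ⟨k, hk, hkω⟩ => q_of_y_RU _ hy ⟨k, hk, blue_of ω k (hCqOut hk) hkω⟩)
    (fun ω hq ⟨k, hk, hkω⟩ => y_of_q_RU _ hq ⟨k, hk, blue_of ω k (hCqOut hk) hkω⟩)
    (fun ω ⟨j, hj, hjω⟩ => y_in_RU _ ⟨j, hj, Finset.mem_union_right _ hjω⟩)
    (fun ω ⟨i, hi, hiω⟩ => q_in_RU _ ⟨i, hi, Finset.mem_union_right _ hiω⟩)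
    (fun ω hy ⟨k, hk, hkω⟩ => q_of_y_RU _ hy ⟨k, hk, Finset.mem_union_right _ hkω⟩)
    (fun ω hq ⟨k, hk, hkω⟩ => y_of_q_RS _ hq ⟨k, hk, Finset.mem_union_right _ hkω⟩)
  convert hcore using 4 <;> rfl

end Coefficientwise

end Summit.CriticalPhenomena.PercolationContinuityZ3.Theorems
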